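import Mathlib

/-!
# Alignment in every degree: the aligned Type II sum keeps a fraction `1/D` of its trivial bound
# on average over sign patterns of the small variable — PROVED

Solo seat `solo-Parity-blind` (summit `Parity`, conjunct `BatemanHorn`), session 8.

`SoloBlindAlignment.lean` (landed) decides Ford–Maynard-type Type II hypotheses with FREE coefficients
for `k² + 1` by an identity: a prime `p > 2x` divides `k² + 1` for at most ONE `k ≤ x`, so the coefficient
on `p` can copy the sign of the cofactor and the bilinear form `∑_m ∑_p ξ_m κ_p 1_J(mp)` equals its
trivial bound for EVERY sign pattern `ξ` (Liouville included).  For a general polynomial sequence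
`v(k) = f(k)`, `deg f = d ≥ 3`, exact uniqueness fails: a modulus `n > x` is attached to at most
`ρ_f(n)` values `k ≤ x` (one per root class; `rho_le_natDegree`: `ρ_f(p) ≤ d` for primes `p` with
`f mod p ≠ 0`), and for a FIXED `ξ` the `≤ D` cofactor signs in a fibre may cancel.  This file proves
the unconditional substitute that decides the general case:

* `pow_card_le_sum_abs_signSum` — **pairing lemma**: for a nonempty finite set `C ⊆ M` of (distinct)
  cofactors, `∑_{U ⊆ M} |∑_{m ∈ C} sgn_U(m)| ≥ 2^{#M}`, where `sgn_U = −1` on `U` and `+1` off `U`;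
  i.e. the average over all sign patterns of `|fibre sum|` is at least `1`.  Proof: flipping the sign of
  one fixed `m₀ ∈ C` is an involution of the patterns that moves the fibre sum by exactly `2`, so paired
  patterns have `|S| + |S'| ≥ 2`.
* `bilin_sgn_aligned_eq` — with the ALIGNED coefficient `κ_n := sign(fibre sum at n)` the bilinear form
  `B(ξ, κ) = ∑_{k ≤ x} ∑_{n ∈ N(k)} ξ(v(k)/n) κ_n` equals `∑_n |fibre sum|` (no cancellation across fibres).
* `edgeCount_mul_pow_le_sum_bilin` — **main theorem**: if every modulus `n` is attached to at most `D`
  indices `k ≤ x` (`D = max ρ_f(n)`), `v` is injective on `[0, x]` and `n ∣ v(k)` on edges, then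
  `2^{#M} · E ≤ D · ∑_{U ⊆ M} B(sgn_U, κ(sgn_U))`, `E = #edges` = the trivial bound of the all-ones
  pattern; hence (`exists_sign_pattern`) some sign pattern `ξ ∈ {±1}^M` has `D · B(ξ, κ(ξ)) ≥ E ≥ T(ξ, κ(ξ))`:
  a positive FRACTION `1/D` of the trivial bound survives, uniformly in the range of the variables.
* `card_fibre_le_rho`, `rho_le_natDegree` — the number theory supplying `D`: for `x < n` at most `ρ_f(n)`
  indices `k ≤ x` have `n ∣ f(k)`, and `ρ_f(p) ≤ deg f` for primes `p` not dividing `f`.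

Why averaging (and not a fixed `ξ` such as `λ`) is the right statement: Ford–Maynard's (II) quantifies over
ALL bounded coefficient pairs, so ONE pair without a log-power saving refutes it; a random sign pattern on
the small variable has square-root cancellation against every smooth comparison sequence `b` (so the
`b`-part of `∑∑ ξ κ (a − b)` is `o(E)` in mean for cofactors `→ ∞`), while by this file its aligned `a`-part
is `≥ E/D` in mean; Markov's inequality then produces a single pattern doing both (paper §10.1, Thm 10.1′).
For `d = 2` and prime moduli `> 2x`, `D = 1` and the landed identity is recovered for every `ξ`.
The edge supply `E ≫ x/(log x)^A` in the bottom window `n ∈ (2x, 4x]` comes, for every irreducible `f`,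
from Hooley's equidistribution of the roots of `f` to COMPOSITE moduli (Mathematika 11 (1964)) — prime
moduli are not needed since `κ` is free — and over all `n > 2x` from Chebyshev–Markov–Nagell
(`E ≥ (1 − 1/d − o(1)) x`).  No `sorry`, standard axioms only.
-/

open Finset

namespace Summit.Parity.BatemanHorn.Theorems.SoloBlindAlignmentGeneral

/-! ### Sign patterns indexed by finite sets, and the one-point flip -/

/-- The sign pattern attached to a finite set `U`: `−1` on `U`, `+1` elsewhere. -/
def sgn (U : Finset ℕ) (m : ℕ) : ℤ := if m ∈ U then -1 else 1

/-- `sgn_U(m) ∈ {1, −1}`. -/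
theorem sgn_eq_one_or (U : Finset ℕ) (m : ℕ) : sgn U m = 1 ∨ sgn U m = -1 := by
  unfold sgn; split_ifs <;> simp

/-- `|sgn_U(m)| = 1`. -/
theorem abs_sgn (U : Finset ℕ) (m : ℕ) : |sgn U m| = 1 := by
  rcases sgn_eq_one_or U m with h | h <;> simp [h]

/-- Flip the membership of `m₀` in `U` (remove it if present, insert it if absent). -/
def flipAt (m₀ : ℕ) (U : Finset ℕ) : Finset ℕ := if m₀ ∈ U then U.erase m₀ else insert m₀ U

/-- `m₀ ∈ flipAt m₀ U ↔ m₀ ∉ U`. -/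
theorem mem_flipAt_self {m₀ : ℕ} {U : Finset ℕ} : m₀ ∈ flipAt m₀ U ↔ m₀ ∉ U := by
  unfold flipAt
  split_ifs with h
  · simp [h]
  · simp [h]

/-- For `m ≠ m₀`, membership is unchanged: `m ∈ flipAt m₀ U ↔ m ∈ U`. -/
theorem mem_flipAt_of_ne {m₀ m : ℕ} {U : Finset ℕ} (hm : m ≠ m₀) : m ∈ flipAt m₀ U ↔ m ∈ U := by
  unfold flipAt
  split_ifs with h
  · simp [Finset.mem_erase, hm]
  · simp [Finset.mem_insert, hm]

/-- `flipAt m₀` is an involution. -/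
theorem flipAt_flipAt (m₀ : ℕ) (U : Finset ℕ) : flipAt m₀ (flipAt m₀ U) = U := by
  ext m
  by_cases hm : m = m₀
  · subst hm
    rw [mem_flipAt_self, mem_flipAt_self]
    tauto
  · rw [mem_flipAt_of_ne hm, mem_flipAt_of_ne hm]

/-- `flipAt m₀` preserves `⊆ M` when `m₀ ∈ M`. -/
theorem flipAt_subset {m₀ : ℕ} {U M : Finset ℕ} (hm₀ : m₀ ∈ M) (hU : U ⊆ M) : flipAt m₀ U ⊆ M := by
  intro m hm
  by_cases h : m = m₀
  · subst h; exact hm₀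
  · exact hU ((mem_flipAt_of_ne h).mp hm)

/-- Flipping `m₀` negates `sgn` at `m₀` … -/
theorem sgn_flipAt_self (m₀ : ℕ) (U : Finset ℕ) : sgn (flipAt m₀ U) m₀ = -sgn U m₀ := by
  unfold sgn
  by_cases h : m₀ ∈ U
  · have h' : m₀ ∉ flipAt m₀ U := fun h'' => (mem_flipAt_self.mp h'') h
    simp [h, h']
  · have h' : m₀ ∈ flipAt m₀ U := mem_flipAt_self.mpr h
    simp [h, h']

/-- … and leaves `sgn` unchanged elsewhere. -/
theorem sgn_flipAt_of_ne {m₀ m : ℕ} (U : Finset ℕ) (hm : m ≠ m₀) : sgn (flipAt m₀ U) m = sgn U m := by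
  unfold sgn
  by_cases h : m ∈ U
  · have h' : m ∈ flipAt m₀ U := (mem_flipAt_of_ne hm).mpr h
    simp [h, h']
  · have h' : m ∉ flipAt m₀ U := fun h'' => h ((mem_flipAt_of_ne hm).mp h'')
    simp [h, h']

/-! ### The pairing lemma: the average of `|∑_{m ∈ C} sgn_U(m)|` over `U ⊆ M` is at least `1` -/

/-- The signed sum of a pattern over a set of cofactors, `S_C(U) = ∑_{m ∈ C} sgn_U(m)`. -/
def signSum (C U : Finset ℕ) : ℤ := ∑ m ∈ C, sgn U m

/-- Flipping one member `m₀ ∈ C` moves the signed sum by exactly `2 sgn_U(m₀)`. -/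
theorem signSum_flipAt {C : Finset ℕ} {m₀ : ℕ} (hm₀ : m₀ ∈ C) (U : Finset ℕ) :
    signSum C (flipAt m₀ U) = signSum C U - 2 * sgn U m₀ := by
  unfold signSum
  rw [← Finset.add_sum_erase C _ hm₀, ← Finset.add_sum_erase C (fun m => sgn U m) hm₀,
    sgn_flipAt_self]
  have h : ∑ m ∈ C.erase m₀, sgn (flipAt m₀ U) m = ∑ m ∈ C.erase m₀, sgn U m :=
    Finset.sum_congr rfl fun m hm => sgn_flipAt_of_ne U (Finset.ne_of_mem_erase hm)
  rw [h]
  ring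

/-- Paired patterns carry total absolute signed sum at least `2`. -/
theorem two_le_abs_add_abs {C : Finset ℕ} {m₀ : ℕ} (hm₀ : m₀ ∈ C) (U : Finset ℕ) :
    (2 : ℤ) ≤ |signSum C U| + |signSum C (flipAt m₀ U)| := by
  have hdiff : |signSum C U - signSum C (flipAt m₀ U)| = 2 := by
    rw [signSum_flipAt hm₀]
    rcases sgn_eq_one_or U m₀ with h | h <;> rw [h] <;> simp
  rw [← hdiff]
  exact abs_sub _ _

/-- **Pairing lemma.** For a nonempty `C ⊆ M`: `2^{#M} ≤ ∑_{U ⊆ M} |∑_{m ∈ C} sgn_U(m)|`. -/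
theorem pow_card_le_sum_abs_signSum {M C : Finset ℕ} (hCM : C ⊆ M) (hC : C.Nonempty) :
    (2 : ℤ) ^ M.card ≤ ∑ U ∈ M.powerset, |signSum C U| := by
  obtain ⟨m₀, hm₀⟩ := hC
  have hm₀M : m₀ ∈ M := hCM hm₀
  have hbij : ∑ U ∈ M.powerset, |signSum C U| =
      ∑ U ∈ M.powerset, |signSum C (flipAt m₀ U)| := by
    refine Finset.sum_nbij' (flipAt m₀) (flipAt m₀) ?_ ?_ ?_ ?_ ?_
    · intro U hU
      rw [mem_powerset] at hU ⊢
      exact flipAt_subset hm₀M hU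
    · intro U hU
      rw [mem_powerset] at hU ⊢
      exact flipAt_subset hm₀M hU
    · intro U _; exact flipAt_flipAt m₀ U
    · intro U _; exact flipAt_flipAt m₀ U
    · intro U _; rw [flipAt_flipAt]
  have hconst : ∑ _U ∈ M.powerset, (2 : ℤ) = 2 * 2 ^ M.card := by
    rw [Finset.sum_const, card_powerset, nsmul_eq_mul]
    push_cast
    ring
  have h2 : (2 : ℤ) * 2 ^ M.card ≤ 2 * ∑ U ∈ M.powerset, |signSum C U| := by
    calc (2 : ℤ) * 2 ^ M.card = ∑ _U ∈ M.powerset, (2 : ℤ) := hconst.symm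
      _ ≤ ∑ U ∈ M.powerset, (|signSum C U| + |signSum C (flipAt m₀ U)|) :=
          Finset.sum_le_sum fun U _ => two_le_abs_add_abs hm₀ U
      _ = 2 * ∑ U ∈ M.powerset, |signSum C U| := by
          rw [Finset.sum_add_distrib, ← hbij, two_mul]
  linarith

/-! ### The incidence structure of a polynomial-type sequence and its aligned bilinear form

`x : ℕ` is the length (indices `k ≤ x`), `v : ℕ → ℕ` the sequence (`v k = f(k)`), and `N k` the finite
set of moduli attached to `k` (e.g. the prime factors `> 2x` of `v k`, or its divisors in a window
`(2x, 4x]`).  An EDGE is a pair `(k, n)` with `n ∈ N k`; its cofactor is `v k / n`. -/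

/-- The fibre of a modulus: the indices `k ≤ x` to which `n` is attached. -/
def fibre (x : ℕ) (N : ℕ → Finset ℕ) (n : ℕ) : Finset ℕ := (range (x + 1)).filter (fun k => n ∈ N k)

/-- All moduli that occur. -/
def moduli (x : ℕ) (N : ℕ → Finset ℕ) : Finset ℕ := (range (x + 1)).biUnion N

/-- The cofactors seen in the fibre of `n`. -/
def cofactors (x : ℕ) (v : ℕ → ℕ) (N : ℕ → Finset ℕ) (n : ℕ) : Finset ℕ :=
  (fibre x N n).image (fun k => v k / n)

/-- The number of edges `E = ∑_{k ≤ x} #N(k)` (= the trivial bound of the all-ones coefficients). -/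
def edgeCount (x : ℕ) (N : ℕ → Finset ℕ) : ℕ := ∑ k ∈ range (x + 1), (N k).card

/-- The bilinear form `B(ξ, η) = ∑_{k ≤ x} ∑_{n ∈ N(k)} ξ(v(k)/n) · η(n)`
(`= ∑_m ∑_n ξ_m η_n · #{k ≤ x : v(k) = m n, n ∈ N(k)}`). -/
def bilin (x : ℕ) (v : ℕ → ℕ) (N : ℕ → Finset ℕ) (ξ η : ℕ → ℤ) : ℤ :=
  ∑ k ∈ range (x + 1), ∑ n ∈ N k, ξ (v k / n) * η n

/-- Its trivial bound `T(ξ, η) = ∑_{k ≤ x} ∑_{n ∈ N(k)} |ξ(v(k)/n)| · |η(n)|`. -/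
def trivialBound (x : ℕ) (v : ℕ → ℕ) (N : ℕ → Finset ℕ) (ξ η : ℕ → ℤ) : ℤ :=
  ∑ k ∈ range (x + 1), ∑ n ∈ N k, |ξ (v k / n)| * |η n|

/-- The fibre sum `S_n(ξ) = ∑_{k ∈ fibre(n)} ξ(v(k)/n)`. -/
def fibreSum (x : ℕ) (v : ℕ → ℕ) (N : ℕ → Finset ℕ) (ξ : ℕ → ℤ) (n : ℕ) : ℤ :=
  ∑ k ∈ fibre x N n, ξ (v k / n)

/-- The ALIGNED coefficient on the modulus: the sign of the fibre sum. -/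
def aligned (x : ℕ) (v : ℕ → ℕ) (N : ℕ → Finset ℕ) (ξ : ℕ → ℤ) (n : ℕ) : ℤ :=
  Int.sign (fibreSum x v N ξ n)

/-- `|κ_n| ≤ 1`. -/
theorem abs_aligned_le_one (x : ℕ) (v : ℕ → ℕ) (N : ℕ → Finset ℕ) (ξ : ℕ → ℤ) (n : ℕ) :
    |aligned x v N ξ n| ≤ 1 := by
  unfold aligned
  rcases lt_trichotomy (fibreSum x v N ξ n) 0 with h | h | h
  · rw [Int.sign_eq_neg_one_of_neg h]; simp
  · rw [h]; simp
  · rw [Int.sign_eq_one_of_pos h]; simp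

/-- The triangle inequality `|B| ≤ T`. -/
theorem abs_bilin_le_trivialBound (x : ℕ) (v : ℕ → ℕ) (N : ℕ → Finset ℕ) (ξ η : ℕ → ℤ) :
    |bilin x v N ξ η| ≤ trivialBound x v N ξ η := by
  unfold bilin trivialBound
  refine (Finset.abs_sum_le_sum_abs _ _).trans (Finset.sum_le_sum fun k _ => ?_)
  refine (Finset.abs_sum_le_sum_abs _ _).trans (Finset.sum_le_sum fun p _ => ?_)
  rw [abs_mul]

/-- The membership dictionary used to swap the order of summation (`Finset.sum_comm'`). -/
theorem mem_iff (x : ℕ) (N : ℕ → Finset ℕ) (k n : ℕ) :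
    k ∈ range (x + 1) ∧ n ∈ N k ↔ k ∈ fibre x N n ∧ n ∈ moduli x N := by
  simp only [fibre, moduli, Finset.mem_filter, Finset.mem_biUnion]
  constructor
  · rintro ⟨hk, hn⟩; exact ⟨⟨hk, hn⟩, k, hk, hn⟩
  · rintro ⟨⟨hk, hn⟩, _⟩; exact ⟨hk, hn⟩

/-- Summation by fibres: `B(ξ, η) = ∑_{n} η(n) · S_n(ξ)`. -/
theorem bilin_eq_sum_fibreSum (x : ℕ) (v : ℕ → ℕ) (N : ℕ → Finset ℕ) (ξ η : ℕ → ℤ) :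
    bilin x v N ξ η = ∑ n ∈ moduli x N, η n * fibreSum x v N ξ n := by
  unfold bilin fibreSum
  rw [Finset.sum_comm' (mem_iff x N)]
  refine Finset.sum_congr rfl fun n _ => ?_
  rw [Finset.mul_sum]
  refine Finset.sum_congr rfl fun k _ => ?_
  ring

/-- The edge count by fibres: `E = ∑_n #fibre(n)`. -/
theorem edgeCount_eq_sum_card_fibre (x : ℕ) (N : ℕ → Finset ℕ) :
    edgeCount x N = ∑ n ∈ moduli x N, (fibre x N n).card := by
  unfold edgeCount
  simp_rw [Finset.card_eq_sum_ones]
  exact Finset.sum_comm' (mem_iff x N)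

/-- `a · sign a = |a|` on `ℤ`. -/
theorem sign_mul_self_eq_abs (a : ℤ) : Int.sign a * a = |a| := by
  rcases lt_trichotomy a 0 with h | h | h
  · rw [Int.sign_eq_neg_one_of_neg h, abs_of_neg h]; ring
  · rw [h]; simp
  · rw [Int.sign_eq_one_of_pos h, abs_of_pos h]; ring

/-- **Alignment across fibres.** With the aligned coefficient, `B(ξ, κ(ξ)) = ∑_n |S_n(ξ)|`:
no cancellation BETWEEN fibres, whatever `ξ` is. -/
theorem bilin_aligned_eq_sum_abs (x : ℕ) (v : ℕ → ℕ) (N : ℕ → Finset ℕ) (ξ : ℕ → ℤ) :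
    bilin x v N ξ (aligned x v N ξ) = ∑ n ∈ moduli x N, |fibreSum x v N ξ n| := by
  rw [bilin_eq_sum_fibreSum]
  refine Finset.sum_congr rfl fun n _ => ?_
  exact sign_mul_self_eq_abs _

/-- Inside one fibre the cofactors are DISTINCT (when `v` is injective on `[0, x]` and `n ∣ v(k)` on
edges), so the fibre sum of a pattern `sgn_U` is the signed sum over the cofactor set. -/
theorem fibreSum_sgn_eq_signSum (x : ℕ) {v : ℕ → ℕ} {N : ℕ → Finset ℕ}
    (hv : Set.InjOn v ↑(range (x + 1))) (hdvd : ∀ k ∈ range (x + 1), ∀ n ∈ N k, n ∣ v k)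
    (U : Finset ℕ) (n : ℕ) :
    fibreSum x v N (sgn U) n = signSum (cofactors x v N n) U := by
  unfold fibreSum signSum cofactors
  rw [Finset.sum_image]
  intro k hk k' hk' h
  simp only [fibre, Finset.mem_coe, Finset.mem_filter] at hk hk'
  have h' : v k / n = v k' / n := h
  have e1 : n * (v k / n) = v k := Nat.mul_div_cancel' (hdvd k hk.1 n hk.2)
  have e2 : n * (v k' / n) = v k' := Nat.mul_div_cancel' (hdvd k' hk'.1 n hk'.2)
  have hvv : v k = v k' := by rw [← e1, ← e2, h']
  exact hv (Finset.mem_coe.mpr hk.1) (Finset.mem_coe.mpr hk'.1) hvv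

/-- **Main theorem (alignment in every degree).** If every modulus is attached to at most `D` indices,
`v` is injective on `[0, x]`, `n ∣ v(k)` on edges, and `M` contains every cofactor, then
`2^{#M} · E ≤ D · ∑_{U ⊆ M} B(sgn_U, κ(sgn_U))`: on average over the `2^{#M}` sign patterns of the
small variable, the aligned bilinear form keeps at least the fraction `1/D` of the edge count. -/
theorem edgeCount_mul_pow_le_sum_bilin (x D : ℕ) {v : ℕ → ℕ} {N : ℕ → Finset ℕ} {M : Finset ℕ}
    (hv : Set.InjOn v ↑(range (x + 1))) (hdvd : ∀ k ∈ range (x + 1), ∀ n ∈ N k, n ∣ v k)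
    (hM : ∀ k ∈ range (x + 1), ∀ n ∈ N k, v k / n ∈ M)
    (hD : ∀ n ∈ moduli x N, (fibre x N n).card ≤ D) :
    (2 : ℤ) ^ M.card * edgeCount x N ≤
      D * ∑ U ∈ M.powerset, bilin x v N (sgn U) (aligned x v N (sgn U)) := by
  -- Step 1: the sum over patterns, fibre by fibre.
  have hswap : ∑ U ∈ M.powerset, bilin x v N (sgn U) (aligned x v N (sgn U)) =
      ∑ n ∈ moduli x N, ∑ U ∈ M.powerset, |signSum (cofactors x v N n) U| := by
    rw [Finset.sum_comm]
    refine Finset.sum_congr rfl fun U _ => ?_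
    rw [bilin_aligned_eq_sum_abs]
    refine Finset.sum_congr rfl fun n _ => ?_
    rw [fibreSum_sgn_eq_signSum x hv hdvd U n]
  -- Step 2: each fibre is nonempty with cofactors in `M`, so the pairing lemma applies.
  have hfib : ∀ n ∈ moduli x N, (2 : ℤ) ^ M.card ≤ ∑ U ∈ M.powerset, |signSum (cofactors x v N n) U| := by
    intro n hn
    apply pow_card_le_sum_abs_signSum
    · intro m hm
      simp only [cofactors, Finset.mem_image, fibre, Finset.mem_filter] at hm
      obtain ⟨k, ⟨hk, hkn⟩, rfl⟩ := hm
      exact hM k hk n hkn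
    · simp only [cofactors, Finset.image_nonempty, fibre]
      simp only [moduli, Finset.mem_biUnion] at hn
      obtain ⟨k, hk, hkn⟩ := hn
      exact ⟨k, Finset.mem_filter.mpr ⟨hk, hkn⟩⟩
  -- Step 3: count edges by fibres and use `#fibre ≤ D`.
  have hE : (edgeCount x N : ℤ) ≤ D * (moduli x N).card := by
    rw [edgeCount_eq_sum_card_fibre, Nat.cast_sum]
    calc ∑ n ∈ moduli x N, ((fibre x N n).card : ℤ) ≤ ∑ _n ∈ moduli x N, (D : ℤ) :=
          Finset.sum_le_sum fun n hn => by exact_mod_cast hD n hn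
      _ = D * (moduli x N).card := by rw [Finset.sum_const, nsmul_eq_mul]; ring
  have hsum : (2 : ℤ) ^ M.card * (moduli x N).card ≤
      ∑ n ∈ moduli x N, ∑ U ∈ M.powerset, |signSum (cofactors x v N n) U| := by
    calc (2 : ℤ) ^ M.card * (moduli x N).card = ∑ _n ∈ moduli x N, (2 : ℤ) ^ M.card := by
            rw [Finset.sum_const, nsmul_eq_mul]; ring
      _ ≤ _ := Finset.sum_le_sum hfib
  rw [hswap]
  have h2pos : (0 : ℤ) ≤ 2 ^ M.card := by positivity
  have hDpos : (0 : ℤ) ≤ D := by positivity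
  calc (2 : ℤ) ^ M.card * edgeCount x N ≤ 2 ^ M.card * (D * (moduli x N).card) :=
        mul_le_mul_of_nonneg_left hE h2pos
    _ = D * (2 ^ M.card * (moduli x N).card) := by ring
    _ ≤ D * ∑ n ∈ moduli x N, ∑ U ∈ M.powerset, |signSum (cofactors x v N n) U| :=
        mul_le_mul_of_nonneg_left hsum hDpos

/-- **Corollary (one good pattern).** Under the same hypotheses there is a sign pattern `ξ = sgn_U`,
`U ⊆ M`, with `E ≤ D · B(ξ, κ(ξ))`; and always `T(ξ, κ(ξ)) ≤ E`, so `B ≥ T/D`: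
a fraction `1/D` of the trivial bound survives. -/
theorem exists_sign_pattern (x D : ℕ) {v : ℕ → ℕ} {N : ℕ → Finset ℕ} {M : Finset ℕ}
    (hv : Set.InjOn v ↑(range (x + 1))) (hdvd : ∀ k ∈ range (x + 1), ∀ n ∈ N k, n ∣ v k)
    (hM : ∀ k ∈ range (x + 1), ∀ n ∈ N k, v k / n ∈ M)
    (hD : ∀ n ∈ moduli x N, (fibre x N n).card ≤ D) :
    ∃ U ∈ M.powerset,
      (edgeCount x N : ℤ) ≤ D * bilin x v N (sgn U) (aligned x v N (sgn U)) ∧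
      trivialBound x v N (sgn U) (aligned x v N (sgn U)) ≤ edgeCount x N := by
  have hmain := edgeCount_mul_pow_le_sum_bilin x D hv hdvd hM hD
  have hne : M.powerset.Nonempty := ⟨∅, Finset.empty_mem_powerset M⟩
  have hle : ∑ _U ∈ M.powerset, (edgeCount x N : ℤ) ≤
      ∑ U ∈ M.powerset, (D : ℤ) * bilin x v N (sgn U) (aligned x v N (sgn U)) := by
    rw [Finset.sum_const, card_powerset, nsmul_eq_mul, ← Finset.mul_sum]
    push_cast
    exact hmain
  obtain ⟨U, hU, hUle⟩ := Finset.exists_le_of_sum_le hne hle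
  refine ⟨U, hU, hUle, ?_⟩
  -- the trivial bound of a sign pattern against a coefficient of modulus ≤ 1 is at most the edge count
  unfold trivialBound edgeCount
  rw [Nat.cast_sum]
  refine Finset.sum_le_sum fun k _ => ?_
  rw [Finset.card_eq_sum_ones, Nat.cast_sum, Nat.cast_one]
  refine Finset.sum_le_sum fun n _ => ?_
  rw [abs_sgn, one_mul]
  exact abs_aligned_le_one x v N (sgn U) n

/-! ### The number theory supplying `D`: root classes -/

/-- `ρ_f(n) = #{r mod n : f(r) ≡ 0 (mod n)}`, counted on the representatives `0 ≤ r < n`. -/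
def rho (f : Polynomial ℤ) (n : ℕ) : ℕ :=
  ((range n).filter (fun r : ℕ => (n : ℤ) ∣ f.eval (r : ℤ))).card

/-- **At most one index per root class.** For `x < n`, at most `ρ_f(n)` indices `k ≤ x` have `n ∣ f(k)`
(for `f = X² + 1` and a prime `n = p > 2x` this is the landed uniqueness lemma, `ρ = 2` but only ONE of
the two roots `ν, p − ν` lies below `x`; in general each root class `r mod n` meets `[0, x]` at most once). -/
theorem card_fibre_le_rho (f : Polynomial ℤ) {x n : ℕ} (hxn : x < n) :
    ((range (x + 1)).filter (fun k : ℕ => (n : ℤ) ∣ f.eval (k : ℤ))).card ≤ rho f n := by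
  unfold rho
  refine Finset.card_le_card (Finset.filter_subset_filter _ fun k hk => ?_)
  exact Finset.mem_range.mpr (lt_of_lt_of_le (Finset.mem_range.mp hk) (Nat.succ_le_of_lt hxn))

/-- **Lagrange.** For a prime `p` with `f mod p ≠ 0`: `ρ_f(p) ≤ deg f`. -/
theorem rho_le_natDegree (f : Polynomial ℤ) {p : ℕ} [hp : Fact p.Prime]
    (hf : f.map (Int.castRingHom (ZMod p)) ≠ 0) : rho f p ≤ f.natDegree := by
  set g : Polynomial (ZMod p) := f.map (Int.castRingHom (ZMod p)) with hg
  have h1 : rho f p ≤ g.roots.toFinset.card := by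
    unfold rho
    refine Finset.card_le_card_of_injOn (fun r : ℕ => (r : ZMod p)) ?_ ?_
    · intro r hr
      simp only [Finset.mem_coe, Finset.mem_filter, Finset.mem_range] at hr
      dsimp only
      rw [Finset.mem_coe, Multiset.mem_toFinset, Polynomial.mem_roots hf, Polynomial.IsRoot.def]
      have hc : (r : ZMod p) = ((r : ℤ) : ZMod p) := (Int.cast_natCast r).symm
      rw [hc, hg, Polynomial.eval_intCast_map, eq_intCast]
      exact (ZMod.intCast_zmod_eq_zero_iff_dvd _ p).mpr hr.2
    · intro r hr r' hr' h
      simp only [Finset.mem_coe, Finset.mem_filter, Finset.mem_range] at hr hr'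
      have h' := (ZMod.natCast_eq_natCast_iff' r r' p).mp h
      rwa [Nat.mod_eq_of_lt hr.1, Nat.mod_eq_of_lt hr'.1] at h'
  calc rho f p ≤ g.roots.toFinset.card := h1
    _ ≤ Multiset.card g.roots := Multiset.toFinset_card_le _
    _ ≤ g.natDegree := Polynomial.card_roots' g
    _ ≤ f.natDegree := Polynomial.natDegree_map_le

end Summit.Parity.BatemanHorn.Theorems.SoloBlindAlignmentGeneral
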